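import Summits.Ventures.YMGap.RobustBall.PlaquettePositivity
import Summits.Ventures.YMGap.RobustBall.StringTensionOnBall
import Summits.Ventures.YMGap.SlabAreaLawDimensions
import Summits.Ventures.YMGap.SlabAreaLawCNS
import Literature.MathematicalPhysics.QuantumFieldTheory.StaticPotentialConcavity
import Literature.MathematicalPhysics.QuantumFieldTheory.LatticeGaugeStringTensionProofs
import Literature.MathematicalPhysics.QuantumLattice.WilsonLoopsProofs
import HarnessLib

/-!
# Venture YMGap, track ROBUST-BALL — the Wilson string tension EXISTS at every coupling; confinement
# on the certified strong-coupling windows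

HONEST FRAMING. WHAT THIS IS: a venture file (cell `pub-ymgap`, track Y2, seat rb-p2 g3): LATTICE
statements about the infinite-volume limit states of Wilson's `SU(N)` lattice gauge theory (subsequential
limits of the torus Wilson states `μ_{Λ_L, β}` on bounded continuous cylinder observables; tree coupling
`β`, i.e. `β = β_W / N` in Wilson's normalisation). «String tension» and «confinement» are the tree's
`HasStringTension` / `IsConfining` (Wilson's criterion for the fundamental string tension of a limit
state, Seiler LNP 159 §2). WHAT IT IS NOT: nothing about non-Wilson members of the robust ball (no
reflection positivity there), nothing about the continuum limit, a spectral gap, or a Clay-sense gap.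

RESULTS (`G ≅ SU(N)`, `N ≥ 2`, `d ≥ 2`):
* `rectExpectation_pos_of_one_one_pos` — for a limit state at `β ≥ 0`, `W(1,1) > 0` alone forces
  `W(R,T) > 0` for all `R, T` (log-convexity in `T` at `R = 1` from `W(1,0) = 1`, then in `R` at each
  `T` from `W(0,T) = 1`; the tree's reflection-positivity inequalities
  `rectExpectation_nonneg_and_logConvex(_snd)` and `StaticPotential.pos_of_logConvex`);
* `rectExpectation_pos` — hence, by plaquette positivity (`PlaquettePositivity.rectExpectation_one_one_pos`),
  **every rectangular Wilson loop expectation of every limit state is strictly positive at every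
  `β > 0`**: the non-vanishing hypothesis `hW` of the tree's `exists_hasStringTension`,
  `StaticPotentialConcavity` (`hasStaticPotential_staticPotential`, `staticPotential_concave`, …) is
  DISCHARGED at every coupling;
* `hasStringTension` — **the string tension `σ(μ) ≥ 0` EXISTS for every limit state at every
  `β > 0`** (`exists_hasStringTension_holds`), with `σ(μ) ≤ -log W_μ(1,1) ≤ -log u₀(β)` explicit
  (`stringTension_le`); previously in the tree only for `0 < β ≤ β₂` with the astronomically small
  `β₂` of `PlaquetteLowerBound.exists_rectExpectation_one_one_ge`;
* `isConfining_of_hasAreaLaw` — **CONFINEMENT**: wherever the volume-uniform torus area law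
  `HasAreaLaw d ρ β` holds (`β > 0`), EVERY infinite-volume limit state is confining,
  `IsConfining μ χ_N` (`σ(μ) ≥ c > 0`); instances on the cell's hypothesis-free Wilson rows:
  `su2_isConfining` (`SU(2)`, every `d ≥ 2`, all `0 < β_W < 2/(d-1)`; `d = 4`: `β_W < 2/3`,
  `su2_isConfining_dim4`; `d = 3`: `β_W < 1`, `su2_isConfining_dim3`) and `suN_isConfining_cns` (every
  `N ≥ 2`, 't Hooft `0 < β < 1/(8(d-1))`, the Cao–Nissim–Sheffield threshold, via
  `Slab.hasAreaLaw_of_lt_cnsThreshold` + `durhuusFrohlich_areaLaw_of_slabClustering_holds`);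
* `hasStaticPotential` — the static potential `V(R)` exists for every `R` at every `β > 0`;
* `wilson_stringTension_onBall` — the Wilson member of the robust ball: under `AreaLawOnBall` the
  clause «`σ ≥ c` whenever `σ` exists» of `stringTension_onBall` becomes «`σ` exists and `σ ≥ c`».

References: K. Wilson, Phys. Rev. D 10 (1974) 2445; E. Seiler, LNP 159 (1982) §2; C. Bachas,
Phys. Rev. D 33 (1986) 2723. Everything here is proved; no definition, no named fact. [folklore]
-/

noncomputable section

open MeasureTheory Filter Topology Finset
open Literature.Probability.LatticeModels
open Literature.MathematicalPhysics.QuantumLattice Literature.MathematicalPhysics.QuantumFieldTheory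

namespace Summit.Ventures.YMGap.RobustBall

namespace WilsonStringTension

section General

variable {d N : ℕ} [NeZero d] {G : Type*} [Group G] [TopologicalSpace G] [IsTopologicalGroup G]
  [CompactSpace G] [MeasurableSpace G] [BorelSpace G] [SecondCountableTopology G] [T2Space G]
  (ρ : G →* Matrix (Fin N) (Fin N) ℂ)

omit [SecondCountableTopology G] [T2Space G] in
/-- **All loops are positive once the plaquette is**: for an infinite-volume limit state at `β ≥ 0`
(continuous `ρ`, `N ≥ 1`, `d ≥ 2`), `W(1,1) > 0` implies `W(R,T) > 0` for all `R, T`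
(reflection positivity: log-convexity in `T` at `R = 1`, then in `R` at each `T`). [folklore] -/
theorem rectExpectation_pos_of_one_one_pos (hd : 2 ≤ d) (hρ : Continuous ρ) (hN : N ≠ 0)
    {β : ℝ} (hβ : 0 ≤ β) {μ : Measure (LGConfig d G)} (hμ : μ ∈ infiniteVolumeLimitPoints ρ β)
    (h11 : 0 < rectExpectation μ (fun g => normalisedCharacter N (ρ g)) 0 1 1 1) (R T : ℕ) :
    0 < rectExpectation μ (fun g => normalisedCharacter N (ρ g)) 0 1 R T := by
  obtain ⟨φ, hφ, hlim⟩ := hμ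
  haveI := hlim.1
  set χ : G → ℝ := fun g => normalisedCharacter N (ρ g) with hχ
  have hχinv : ∀ g, χ g⁻¹ = χ g := fun g => by
    simp only [hχ, normalisedCharacter,
      Literature.RepresentationTheory.CompactGroups.CompactGroup.re_trace_map_inv ρ hρ]
  have hsnd0 : ∀ R' : ℕ, rectExpectation μ χ 0 1 R' 0 = 1 := fun R' => by
    haveI : IsProbabilityMeasure (μ.map (configPermZd (G := G) (Equiv.swap (0 : Fin d) 1))) :=
      Measure.isProbabilityMeasure_map (configPermZd _).measurable.aemeasurable
    rw [rectExpectation_eq_swap μ χ hχinv R' 0]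
    exact rectExpectation_zero_eq_one ρ hN _ 0 1 R'
  have h1 : ∀ T' : ℕ, 0 < rectExpectation μ χ 0 1 1 T' :=
    StaticPotential.pos_of_logConvex (W := fun T' => rectExpectation μ χ 0 1 1 T')
      (by show 0 < rectExpectation μ χ 0 1 1 0; rw [hsnd0]; exact one_pos) h11
      (fun T' => (StaticPotential.rectExpectation_nonneg_and_logConvex_snd ρ hd hρ hβ hφ hlim 1 T').1)
      (fun T' => (StaticPotential.rectExpectation_nonneg_and_logConvex_snd ρ hd hρ hβ hφ hlim 1 T').2)
  exact StaticPotential.pos_of_logConvex (W := fun R' => rectExpectation μ χ 0 1 R' T)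
    (by show 0 < rectExpectation μ χ 0 1 0 T; rw [rectExpectation_zero_eq_one ρ hN μ 0 1 T]; exact one_pos)
    (h1 T)
    (fun R' => (rectExpectation_nonneg_and_logConvex ρ hd hρ hβ hφ hlim T R').1)
    (fun R' => (rectExpectation_nonneg_and_logConvex ρ hd hρ hβ hφ hlim T R').2) R

/-- **Every rectangular Wilson loop expectation of every limit state is strictly positive, at every
coupling `β > 0`** (`G ≅ SU(N)`, `N ≥ 2`, `d ≥ 2`): plaquette positivity + reflection positivity.
[folklore] -/
theorem rectExpectation_pos (hρ : IsSpecialUnitaryModel ρ) (hN : 2 ≤ N) (hd : 2 ≤ d) {β : ℝ}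
    (hβ : 0 < β) {μ : Measure (LGConfig d G)} (hμ : μ ∈ infiniteVolumeLimitPoints ρ β) (R T : ℕ) :
    0 < rectExpectation μ (fun g => normalisedCharacter N (ρ g)) 0 1 R T :=
  rectExpectation_pos_of_one_one_pos ρ hd hρ.1 (by omega) hβ.le hμ
    (PlaquettePositivity.rectExpectation_one_one_pos ρ hρ hN hd hβ hμ) R T

/-- The non-vanishing hypothesis `hW` of the tree's string-tension theorems, discharged. [folklore] -/
theorem rectExpectation_ne_zero (hρ : IsSpecialUnitaryModel ρ) (hN : 2 ≤ N) (hd : 2 ≤ d) {β : ℝ}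
    (hβ : 0 < β) {μ : Measure (LGConfig d G)} (hμ : μ ∈ infiniteVolumeLimitPoints ρ β) :
    ∀ R T : ℕ, 1 ≤ R → 1 ≤ T →
      rectExpectation μ (fun g => normalisedCharacter N (ρ g)) 0 1 R T ≠ 0 :=
  fun R T _ _ => (rectExpectation_pos ρ hρ hN hd hβ hμ R T).ne'

/-- **THE STRING TENSION EXISTS AT EVERY COUPLING.** For `G ≅ SU(N)`, `N ≥ 2`, `d ≥ 2`, every
`β > 0` and every infinite-volume limit point `μ` of the torus Wilson states: the static potential
`V(R)` exists for every `R` and the string tension `σ(μ) = lim V(R)/R ≥ 0` exists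
(`HasStringTension`; the tree's `exists_hasStringTension_holds` — reflection positivity / transfer
matrix, Seiler LNP 159 §2 — with its non-vanishing hypothesis discharged by `rectExpectation_ne_zero`).
[folklore] -/
theorem hasStringTension (hρ : IsSpecialUnitaryModel ρ) (hN : 2 ≤ N) (hd : 2 ≤ d) {β : ℝ}
    (hβ : 0 < β) {μ : Measure (LGConfig d G)} (hμ : μ ∈ infiniteVolumeLimitPoints ρ β) :
    ∃ σ : ℝ, 0 ≤ σ ∧ HasStringTension μ (fun g => normalisedCharacter N (ρ g)) σ := by
  haveI : NeZero N := ⟨by omega⟩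
  exact exists_hasStringTension_holds ρ hd hρ.1 (IsSpecialUnitaryModel.mem_unitaryGroup ρ hρ) hβ.le hμ
    (rectExpectation_ne_zero ρ hρ hN hd hβ hμ)

/-- **The static potential exists at every separation, at every coupling**: `V(R) = staticPotential μ χ R`
satisfies `HasStaticPotential` for every `R` (lit-1's `StaticPotential.hasStaticPotential_staticPotential`, now
hypothesis-free); with it the whole concavity chain of `StaticPotentialConcavity` (`V(0) = 0`, `V ≥ 0`, concave,
monotone, `V(R) ≤ R·V(1)`) applies to every limit state at every `β > 0`. [folklore] -/
theorem hasStaticPotential (hρ : IsSpecialUnitaryModel ρ) (hN : 2 ≤ N) (hd : 2 ≤ d) {β : ℝ}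
    (hβ : 0 < β) {μ : Measure (LGConfig d G)} (hμ : μ ∈ infiniteVolumeLimitPoints ρ β) (R : ℕ) :
    HasStaticPotential μ (fun g => normalisedCharacter N (ρ g)) R
      (staticPotential μ (fun g => normalisedCharacter N (ρ g)) R) :=
  StaticPotential.hasStaticPotential_staticPotential ρ hd hρ.1 hβ.le hμ
    (rectExpectation_ne_zero ρ hρ hN hd hβ hμ) R

/-- **The string tension is the tree's `stringTension μ χ`, it is `≥ 0`, and it is bounded above
explicitly**: `σ(μ) ≤ -log W_μ(1,1) ≤ -log u₀(β)` with `u₀(β) = β e^{-8(d-1)Nβ} V₀ / (2(d-1)N)`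
(Seiler's bound by the plaquette, `StaticPotential.stringTension_le_neg_log_plaquette`, now
hypothesis-free). [folklore] -/
theorem stringTension_le (hρ : IsSpecialUnitaryModel ρ) (hN : 2 ≤ N) (hd : 2 ≤ d) {β : ℝ}
    (hβ : 0 < β) {μ : Measure (LGConfig d G)} (hμ : μ ∈ infiniteVolumeLimitPoints ρ β) :
    0 ≤ stringTension μ (fun g => normalisedCharacter N (ρ g)) ∧
      HasStringTension μ (fun g => normalisedCharacter N (ρ g))
        (stringTension μ (fun g => normalisedCharacter N (ρ g))) ∧
      stringTension μ (fun g => normalisedCharacter N (ρ g)) ≤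
        -Real.log (rectExpectation μ (fun g => normalisedCharacter N (ρ g)) 0 1 1 1) ∧
      -Real.log (rectExpectation μ (fun g => normalisedCharacter N (ρ g)) 0 1 1 1) ≤
        -Real.log (β * Real.exp (-(8 * ((d : ℝ) - 1) * N * β)) * PlaquetteLowerBound.charVariance ρ /
          (2 * ((d : ℝ) - 1) * N)) := by
  have hW := rectExpectation_ne_zero ρ hρ hN hd hβ hμ
  obtain ⟨h0, hσ⟩ := StaticPotential.stringTension_nonneg_and_hasStringTension ρ hd hρ.1 hβ.le hμ hW
  refine ⟨h0, hσ, StaticPotential.stringTension_le_neg_log_plaquette ρ hd hρ.1 hβ.le hμ hW, ?_⟩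
  have hu := PlaquettePositivity.rectExpectation_one_one_ge ρ hρ hN hd hβ.le hμ
  have hV := PlaquetteLowerBound.charVariance_pos ρ hρ.1 (by omega)
  have hN0 : (0 : ℝ) < N := by exact_mod_cast (show 0 < N by omega)
  have hdpos : (0 : ℝ) < 2 * ((d : ℝ) - 1) := by
    have : (2 : ℝ) ≤ d := by exact_mod_cast hd
    linarith
  have hu0 : 0 < β * Real.exp (-(8 * ((d : ℝ) - 1) * N * β)) * PlaquetteLowerBound.charVariance ρ /
      (2 * ((d : ℝ) - 1) * N) := by positivity
  exact neg_le_neg (Real.log_le_log hu0 hu)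

/-- **CONFINEMENT FROM THE AREA LAW, hypothesis-free.** If Wilson's volume-uniform torus area law
`HasAreaLaw d ρ β` holds at some `β > 0` (`G ≅ SU(N)`, `N ≥ 2`, `d ≥ 2`), then EVERY infinite-volume
limit state at `β` is confining: its string tension exists and is `≥ c > 0`, the area-law rate
(`hasAreaLawState_of_hasAreaLaw_holds`, `HasAreaLawWith.le_of_hasStringTension`). [folklore] -/
theorem isConfining_of_hasAreaLaw (hρ : IsSpecialUnitaryModel ρ) (hN : 2 ≤ N) (hd : 2 ≤ d) {β : ℝ}
    (hβ : 0 < β) (hA : HasAreaLaw d ρ β) {μ : Measure (LGConfig d G)}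
    (hμ : μ ∈ infiniteVolumeLimitPoints ρ β) :
    IsConfining μ (fun g => normalisedCharacter N (ρ g)) := by
  haveI : NeZero N := ⟨by omega⟩
  obtain ⟨C, c, hc, hAW⟩ := hasAreaLawState_of_hasAreaLaw_holds ρ hd hρ.1 hA hμ
  obtain ⟨σ, -, hσ⟩ := hasStringTension ρ hρ hN hd hβ hμ
  exact ⟨σ, lt_of_lt_of_le hc (hAW.le_of_hasStringTension hσ), hσ⟩

/-- Quantitative form: under `HasAreaLaw d ρ β` with constants `(C, c)`, every limit state has a string
tension `σ` with `c ≤ σ ≤ -log W_μ(1,1)`. [folklore] -/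
theorem exists_stringTension_ge_of_hasAreaLawWith (hρ : IsSpecialUnitaryModel ρ) (hN : 2 ≤ N)
    (hd : 2 ≤ d) {β : ℝ} (hβ : 0 < β) {μ : Measure (LGConfig d G)}
    (hμ : μ ∈ infiniteVolumeLimitPoints ρ β) {C c : ℝ}
    (hAW : HasAreaLawWith μ (fun g => normalisedCharacter N (ρ g)) C c) :
    ∃ σ : ℝ, HasStringTension μ (fun g => normalisedCharacter N (ρ g)) σ ∧ c ≤ σ ∧
      σ ≤ -Real.log (rectExpectation μ (fun g => normalisedCharacter N (ρ g)) 0 1 1 1) := by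
  obtain ⟨-, hσ, hle, -⟩ := stringTension_le ρ hρ hN hd hβ hμ
  exact ⟨_, hσ, hAW.le_of_hasStringTension hσ, hle⟩

end General

/-! ### The concrete model `SU(N)` and the cell's hypothesis-free Wilson rows -/

section SU

variable {d : ℕ} [NeZero d]

/-- **`SU(N)`: the string tension exists for every limit state at every `β > 0`** (`N ≥ 2`, `d ≥ 2`),
in the venture's vocabulary (`SUN N`, `fundamentalRep (Fin N)`). [folklore] -/
theorem suN_hasStringTension {N : ℕ} (hN : 2 ≤ N) (hd : 2 ≤ d) {β : ℝ} (hβ : 0 < β)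
    {μ : Measure (LGConfig d (SUN N))} (hμ : μ ∈ infiniteVolumeLimitPoints (fundamentalRep (Fin N)) β) :
    ∃ σ : ℝ, 0 ≤ σ ∧ HasStringTension μ (fun g => normalisedCharacter N (fundamentalRep (Fin N) g)) σ :=
  hasStringTension (fundamentalRep (Fin N)) (TorusAreaLaw.isSpecialUnitaryModel_fundamentalRep N)
    hN hd hβ hμ

/-- **`SU(N)`: every Wilson loop expectation of every limit state is positive at every `β > 0`.**
[folklore] -/
theorem suN_rectExpectation_pos {N : ℕ} (hN : 2 ≤ N) (hd : 2 ≤ d) {β : ℝ} (hβ : 0 < β)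
    {μ : Measure (LGConfig d (SUN N))} (hμ : μ ∈ infiniteVolumeLimitPoints (fundamentalRep (Fin N)) β)
    (R T : ℕ) :
    0 < rectExpectation μ (fun g => normalisedCharacter N (fundamentalRep (Fin N) g)) 0 1 R T :=
  rectExpectation_pos (fundamentalRep (Fin N)) (TorusAreaLaw.isSpecialUnitaryModel_fundamentalRep N)
    hN hd hβ hμ R T

/-- **CONFINEMENT OF `SU(2)` LATTICE YANG–MILLS ON THE CELL'S WILSON WINDOW, hypothesis-free**: for
every `d ≥ 2` and every Wilson coupling `0 < β_W < 2/(d-1)` (`d = 4`: `β_W < 2/3`; `d = 3`: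
`β_W < 1`), EVERY infinite-volume limit state of the torus Wilson states (tree coupling `β_W/2`) is
confining: its fundamental string tension exists and is strictly positive (area law
`su2_hasAreaLaw_of_lt_two_div` of the cell + `isConfining_of_hasAreaLaw`). [folklore] -/
theorem su2_isConfining (hd : 2 ≤ d) {βW : ℝ} (hβ : 0 < βW) (hlt : βW < 2 / ((d : ℝ) - 1))
    {μ : Measure (LGConfig d (SUN 2))}
    (hμ : μ ∈ infiniteVolumeLimitPoints (fundamentalRep (Fin 2)) (βW / 2)) :
    IsConfining μ (fun g => normalisedCharacter 2 (fundamentalRep (Fin 2) g)) :=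
  isConfining_of_hasAreaLaw (fundamentalRep (Fin 2)) (TorusAreaLaw.isSpecialUnitaryModel_fundamentalRep 2)
    le_rfl hd (by positivity) (SlabAreaLawDimensions.su2_hasAreaLaw_of_lt_two_div hd hβ.le hlt) hμ

/-- `SU(2)`, `d = 4`: confinement for all `0 < β_W < 2/3`. [folklore] -/
theorem su2_isConfining_dim4 {βW : ℝ} (hβ : 0 < βW) (hlt : βW < 2 / 3)
    {μ : Measure (LGConfig 4 (SUN 2))}
    (hμ : μ ∈ infiniteVolumeLimitPoints (fundamentalRep (Fin 2)) (βW / 2)) :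
    IsConfining μ (fun g => normalisedCharacter 2 (fundamentalRep (Fin 2) g)) :=
  su2_isConfining (d := 4) (by norm_num) hβ (by norm_num; linarith) hμ

/-- `SU(2)`, `d = 3` (the dimension of the cell's Y4 interface): confinement for all `0 < β_W < 1`.
[folklore] -/
theorem su2_isConfining_dim3 {βW : ℝ} (hβ : 0 < βW) (hlt : βW < 1)
    {μ : Measure (LGConfig 3 (SUN 2))}
    (hμ : μ ∈ infiniteVolumeLimitPoints (fundamentalRep (Fin 2)) (βW / 2)) :
    IsConfining μ (fun g => normalisedCharacter 2 (fundamentalRep (Fin 2) g)) :=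
  su2_isConfining (d := 3) (by norm_num) hβ (by norm_num; linarith) hμ

/-- **Every `N ≥ 2`: confinement below the Cao–Nissim–Sheffield threshold** ('t Hooft coupling
`0 < β < 1/(8(d-1))`, tree coupling `Nβ`; the cell's hypothesis-free every-`N` Wilson area law
`Slab.hasAreaLaw_of_lt_cnsThreshold` on the tree's Durhuus–Fröhlich criterion
`durhuusFrohlich_areaLaw_of_slabClustering_holds`): every infinite-volume limit state is confining.
[folklore] -/
theorem suN_isConfining_cns {N : ℕ} (hN : 2 ≤ N) (hd : 2 ≤ d) {β : ℝ} (hβ : 0 < β)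
    (hlt : β < 1 / (8 * ((d : ℝ) - 1))) {μ : Measure (LGConfig d (SUN N))}
    (hμ : μ ∈ infiniteVolumeLimitPoints (fundamentalRep (Fin N)) ((N : ℝ) * β)) :
    IsConfining μ (fun g => normalisedCharacter N (fundamentalRep (Fin N) g)) := by
  have hN0 : (0 : ℝ) < N := by exact_mod_cast (show 0 < N by omega)
  exact isConfining_of_hasAreaLaw (fundamentalRep (Fin N))
    (TorusAreaLaw.isSpecialUnitaryModel_fundamentalRep N) hN hd (by positivity)
    (Slab.hasAreaLaw_of_lt_cnsThreshold durhuusFrohlich_areaLaw_of_slabClustering_holds hd hN hβ.le hlt) hμ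

/-- **The Wilson member of the robust ball**: under `AreaLawOnBall N d β ε₀ ε₁ r mv` (`d ≥ 2`, `N ≥ 2`,
`β > 0`, `0 ≤ ε₀, ε₁`) there is ONE pair `(C, c)`, `c > 0` — the ball's constants of
`stringTension_onBall` — such that every infinite-volume limit state `μ` of the TORUS WILSON states at
`β` has a string tension `σ(μ)` which EXISTS and satisfies `c ≤ σ(μ)`, and `μ` is confining: the clause
«whenever `σ` exists» of `stringTension_onBall` is discharged for the Wilson member. [folklore] -/
theorem wilson_stringTension_onBall {N : ℕ} (hN : 2 ≤ N) (hd : 2 ≤ d) {β ε₀ ε₁ : ℝ} (hβ : 0 < β)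
    (h₀ : 0 ≤ ε₀) (h₁ : 0 ≤ ε₁) {r mv : ℕ} (h : AreaLawOnBall N d β ε₀ ε₁ r mv) :
    ∃ C c : ℝ, 0 < c ∧ ∀ μ ∈ infiniteVolumeLimitPoints (d := d) (fundamentalRep (Fin N)) β,
      HasAreaLawWith μ (fun g => normalisedCharacter N (fundamentalRep (Fin N) g)) C c ∧
      (∃ σ : ℝ, HasStringTension μ (fun g => normalisedCharacter N (fundamentalRep (Fin N) g)) σ ∧ c ≤ σ) ∧
      IsConfining μ (fun g => normalisedCharacter N (fundamentalRep (Fin N) g)) := by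
  obtain ⟨C, c, hc, hA⟩ := stringTension_onBall (N := N) hd h
  refine ⟨C, c, hc, fun μ hμ => ?_⟩
  have hmem : ∀ᶠ L : ℕ in atTop, (0 : PerturbationFamily d N) L ∈ ClusterDomainFR ε₀ ε₁ r ∧
      IsSlabLocal mv ((0 : PerturbationFamily d N) L) :=
    Eventually.of_forall fun L => ⟨zero_mem_clusterDomainFR h₀ h₁ r,
      ⟨fun v t z _ U => by simp [QuasiLocalGaugePerturbation.total], fun X v => ⟨0, by
        intro U V _; rfl⟩⟩⟩
  have hμ' : μ ∈ perturbedLimitPoints β (0 : PerturbationFamily d N) := by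
    rwa [perturbedLimitPoints_zero]
  obtain ⟨hW, -, hge, hconf⟩ := hA 0 hmem μ hμ'
  obtain ⟨σ, -, hσ⟩ := suN_hasStringTension hN hd hβ hμ
  exact ⟨hW, ⟨σ, hσ, hge σ hσ⟩, hconf ⟨σ, hσ⟩⟩

end SU

end WilsonStringTension

end Summit.Ventures.YMGap.RobustBall
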